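import Summits.Ventures.PercRepro.RankLevelSetExplicitCapArith
import Summits.Ventures.PercRepro.RankLevelSetExplicitAll
import Summits.Ventures.PercRepro.RankLevelSetExplicitCells
import Summits.Ventures.PercRepro.RankLevelSetDepCountSplit
import Summits.Ventures.PercRepro.RankLevelSetCorankFiveCounts

/-!
# PercRepro — THEOREM P‴: C-025 AT EVERY LEVEL `q ≥ 3` FOR EVERY `p ≥ Pcap q`, WITH A SINGLE-EXPONENTIAL THRESHOLD
`Pcap q ≤ (q + 2)·2^{2q+6} + 1` (p9, S4)

`proofs/SUBCLAIM-S4-p9.md` §S4.2″. THEOREM P / P′ (`RankLevelSetExplicitAll` / `…SplitAll`) bound the fibre sums of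
night-1's `U`-count by the saturated local-sparsity bound `σ ≤ 2^{f − q − 1}`, `f = 2^q − 1`, which is what makes their
thresholds doubly exponential (`2^{2^{q−2}}`). p8's NULLITY CAP (`encard_le_eRk_add_of_encard_eq`: a rank-`k` set of a
matroid of nullity `d` has at most `k + d` points) makes BOTH fibre sums of the split count
(`ncard_eRk_eq_ncard_le_le_split` with `f = q + d`, `f′ = q − 1 + d`) at most `Σ_{j ≤ d−q−1} C(d − 1, j) ≤ 2^{d−1}` at EVERY
corank — and that `2^{d−1}` cancels against the `2^{d−q}` on the right of the polynomial inequality `(P_d)`. With the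
circuit sums bounded through Vandermonde (`Σ_{k=3}^{q+1} C(d+k−1, k)·C(n, q+1−k) ≤ C(d+q, 3)·C(n+d+q−3, q−2)`,
`circuit_sum_le_vandermonde`), `(P_d)` holds for every corank `q + 1 ≤ d ≤ q + 2^q` as soon as
`p ≥ Tcap q := (q + 2)·2^{2q+6}` (`poly_main_cap`); coranks `≥ q + 2^q + 1` are `c025_core_explicit_large'`
(`p ≥ 2^{q+1} + 2q² + 4q + 4`). The level induction of THEOREM P then gives

* `c025_cap_all (q) (hq : 3 ≤ q) : ∀ M [M.Finite] p, Pcap q ≤ p → RLS M p q`, `Pcap 3 = 5`,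
  `Pcap (q+1) = max (Pcap q) (Tcap (q+1)) + 1`, and the closed form `Pcap_le_Tcap_succ : Pcap q ≤ Tcap q + 1` (`q ≥ 4`):
  `Tcap 4 = 98 304`, `Tcap 5 = 458 752`, `Tcap 6 = 2 097 152`, `Tcap 7 = 9 437 184`, `Tcap 8 = 41 943 040`,
  `Tcap 10 ≈ 8.1·10^8`, `Tcap 20 ≈ 1.5·10^15` — against `PexpS 7 ≈ 8.6·10^14`, `PexpS 8 ≈ 9.7·10^24`, `PexpS 20 ≈ 2^{2^{18}}`.
Every fact used is a kernel theorem of the cell's tree (night-1's split count and frame, p8's cap lemma, this seat's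
THEOREM P modules) or Mathlib. Axioms: standard.
-/

open scoped Matroid

namespace PercRepro

namespace ThmN

open Set

variable {α : Type}

/-- **The `e`-free core at level `q ≥ 3`, bounded corank `q + 1 ≤ d ≤ q + 2^q`, rank `p ≥ Tcap q`** — the split count
with the NULLITY CAP (`f = q + d`, `f′ = q − 1 + d`: both fibre sums `≤ 2^{d−1}`), the circuit sums through
Vandermonde, the tail `16·Σ_{j ≤ q+2^q} C(n, j) ≤ 2^n`, and `poly_main_cap`. -/
theorem c025_core_cap_bounded (q : ℕ) (hq : 3 ≤ q) (M : Matroid α) [M.Finite] (p d : ℕ)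
    (hp : Explicit.Tcap q ≤ p) (hd1 : q + 1 ≤ d) (hd2 : d ≤ q + 2 ^ q)
    (hR : M.eRank = (p : ℕ∞)) (hn : M.E.ncard = p + d)
    (hfree : ∀ e ∈ M.E, ∃ A ⊆ M.E \ {e}, e ∉ M.closure A ∧ e ∉ M.closure ((M.E \ {e}) \ A)) :
    RLS M p q := by
  classical
  obtain ⟨-, -, htail, -, -⟩ := Explicit.Tcap_bounds q hq
  have hEcard : M.ground_finite.toFinset.card = p + d := by
    rw [← Set.ncard_eq_toFinset_card _ M.ground_finite]; exact hn
  -- the core is simple: every circuit has `≥ 3` elements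
  have hL : ∀ e ∈ M.E, ¬ M.IsLoop e := not_isLoop_of_free M hfree
  have hs : ∀ e ∈ M.E, ∀ f ∈ M.E, e ≠ f → M.eRk {e, f} = 2 := by
    intro e he f hf hef
    have h2 : (2 : ℕ∞) ≤ M.eRk {e, f} :=
      two_le_eRk_of_two_le_ncard_of_free M hfree (pair_subset he hf) (by rw [ncard_pair hef])
    have h3 : M.eRk {e, f} ≤ 2 := by
      have := M.eRk_le_encard {e, f}
      rwa [encard_pair hef] at this
    exact le_antisymm h3 h2
  have hcirc : ∀ C, M.IsCircuit C → 3 ≤ C.encard := three_le_encard_of_circuit M hL hs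
  have hd : M.E.encard = M.eRank + d := by
    rw [hR, ← M.ground_finite.cast_ncard_eq, hn]
    push_cast
    ring
  -- the nullity cap: every `X ⊆ E` has `|X| ≤ r(X) + d`
  have hcap : ∀ X ⊆ M.E, ∀ k : ℕ, M.eRk X ≤ k → X.ncard ≤ k + d := by
    intro X hX k hr
    have h1 := Matroid.encard_le_eRk_add_of_encard_eq hX hd
    have h2 : X.encard ≤ (k : ℕ∞) + d := h1.trans (by gcongr)
    have hfin : X.Finite := M.ground_finite.subset hX
    rw [← hfin.cast_ncard_eq] at h2
    exact_mod_cast h2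
  have hflat : ∀ X ⊆ M.E, M.eRk X ≤ q → X.ncard ≤ q + d := fun X hX hr => hcap X hX q hr
  have hflat' : ∀ X ⊆ M.E, M.eRk X ≤ ((q - 1 : ℕ) : ℕ∞) → X.ncard ≤ q - 1 + d :=
    fun X hX hr => hcap X hX (q - 1) hr
  -- (U): the split count with the cap
  have hU1 := Matroid.topCount_le_ncard_compl (M := M) hR hd q
  have hU2 := Matroid.ncard_eRk_eq_ncard_le_le_split M q (q + d) (q - 1 + d) (by omega) hcirc hflat hflat' hd
  rw [hn, show q - 1 + d - q = d - 1 by omega, show q + d - (q + 1) = d - 1 by omega] at hU2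
  have hσ : ∑ j ∈ Finset.range (d - (q + 1) + 1), (d - 1).choose j ≤ 2 ^ (d - 1) :=
    Explicit.sum_range_choose_le_two_pow (d - 1) _
  -- the circuit sums
  have hcs : ∀ k ∈ Finset.Icc 3 (q + 1), {C | M.IsCircuit C ∧ C.ncard = k}.ncard ≤ (d + k - 1).choose k := by
    intro k hk
    rw [Finset.mem_Icc] at hk
    have := Matroid.ncard_circuits_le_choose_of_encard M hd (k - 1)
    rw [show k - 1 + 1 = k by omega, show d + (k - 1) = d + k - 1 by omega] at this
    exact this
  have hS : ∑ k ∈ Finset.Icc 3 (q + 1), {C | M.IsCircuit C ∧ C.ncard = k}.ncard * (p + d).choose (q + 1 - k) ≤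
      (d + q).choose 3 * (d + q - 3 + (p + d)).choose (q - 2) := by
    refine (Finset.sum_le_sum (fun k hk => Nat.mul_le_mul_right _ (hcs k hk))).trans ?_
    exact Explicit.circuit_sum_le_vandermonde q d (p + d) (by omega)
  have hSb : ∑ k ∈ Finset.Icc 3 (q + 1),
      {C | M.IsCircuit C ∧ C.ncard = k}.ncard * ((q + 1) * d).choose (q + 1 - k) ≤
      (d + q).choose 3 * (d + q - 3 + (q + 1) * d).choose (q - 2) := by
    refine (Finset.sum_le_sum (fun k hk => Nat.mul_le_mul_right _ (hcs k hk))).trans ?_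
    exact Explicit.circuit_sum_le_vandermonde q d ((q + 1) * d) (by omega)
  -- the `N`-term
  set N : ℕ := (∑ j ∈ Finset.range (d - (q + 1) + 1), (d - 1).choose j) *
      ∑ k ∈ Finset.Icc 3 (q + 1), {C | M.IsCircuit C ∧ C.ncard = k}.ncard * (p + d).choose (q + 1 - k) +
    (∑ j ∈ Finset.range (d - (q + 1) + 1), (d - 1).choose j) *
      ∑ k ∈ Finset.Icc 3 (q + 1), {C | M.IsCircuit C ∧ C.ncard = k}.ncard * ((q + 1) * d).choose (q + 1 - k)
    with hNdef
  have hN : N ≤ 2 ^ (d - 1) * ((d + q).choose 3 *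
      ((d + q - 3 + (p + d)).choose (q - 2) + (d + q - 3 + (q + 1) * d).choose (q - 2))) := by
    calc N ≤ 2 ^ (d - 1) * ((d + q).choose 3 * (d + q - 3 + (p + d)).choose (q - 2)) +
          2 ^ (d - 1) * ((d + q).choose 3 * (d + q - 3 + (q + 1) * d).choose (q - 2)) :=
          Nat.add_le_add (Nat.mul_le_mul hσ hS) (Nat.mul_le_mul hσ hSb)
      _ = _ := by ring
  have hU : Matroid.topCount M p q ≤ (p + d).choose q + N := by
    refine hU1.trans (hU2.trans ?_)
    rw [hNdef, add_assoc]
  -- (Y)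
  have hY := Matroid.two_pow_le_midCount_add (M := M) p q hR
  have hA : {X : Set α | X ⊆ M.E ∧ M.eRk X ≤ q}.ncard ≤ ∑ j ∈ Finset.range (q + d + 1), (p + d).choose j := by
    calc {X : Set α | X ⊆ M.E ∧ M.eRk X ≤ q}.ncard
        ≤ {X : Set α | X ⊆ (M.ground_finite.toFinset : Set α) ∧ X.ncard ≤ q + d}.ncard := by
          apply ncard_le_ncard
          · intro X hX
            exact ⟨by rw [Set.Finite.coe_toFinset]; exact hX.1, hflat X hX.1 hX.2⟩
          · exact (Finset.finite_toSet _).finite_subsets.subset (fun X hX => hX.1)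
      _ ≤ ∑ j ∈ Finset.range (q + d + 1), M.ground_finite.toFinset.card.choose j :=
          ncard_subsets_ncard_le _ (q + d)
      _ = ∑ j ∈ Finset.range (q + d + 1), (p + d).choose j := by rw [hEcard]
  have hB := Matroid.ncard_spanning_le (M := M) hd
  rw [hEcard] at hY hB
  -- the tail with `K = 2q + 2^q`
  have hT : 16 * ∑ j ∈ Finset.range (2 * q + 2 ^ q + 1), (p + d).choose j ≤ 2 ^ (p + d) :=
    Explicit.sixteen_mul_sum_range_choose_le (2 * q + 2 ^ q) (p + d) (by omega)
  have hA' : ∑ j ∈ Finset.range (q + d + 1), (p + d).choose j ≤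
      ∑ j ∈ Finset.range (2 * q + 2 ^ q + 1), (p + d).choose j :=
    Finset.sum_le_sum_of_subset_of_nonneg (Finset.range_mono (by omega)) (fun _ _ _ => Nat.zero_le _)
  have hB' : ∑ j ∈ Finset.range (d + 1), (p + d).choose j ≤
      ∑ j ∈ Finset.range (2 * q + 2 ^ q + 1), (p + d).choose j :=
    Finset.sum_le_sum_of_subset_of_nonneg (Finset.range_mono (by omega)) (fun _ _ _ => Nat.zero_le _)
  have hAB : 8 * ({X : Set α | X ⊆ M.E ∧ M.eRk X ≤ q}.ncard +
      {X : Set α | X ⊆ M.E ∧ M.eRk X = M.eRank}.ncard) ≤ 2 ^ (p + d) := by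
    have h1 := hA.trans hA'
    have h2 := hB.trans hB'
    omega
  -- (Φ) and the polynomial inequality
  have hΦ := phiK_le_two_pow_div p q
  rw [Nat.choose_symm_add] at hΦ
  have hpoly := Explicit.poly_main_cap q d p N hq hd1 hd2 hp hN
  -- assemble in `ℚ`
  rw [RLS_iff]
  have hUq : (Matroid.topCount M p q : ℚ) ≤ ((p + d).choose q : ℚ) + (N : ℚ) := by exact_mod_cast hU
  have hYq : (2 : ℚ) ^ (p + d) ≤ (Matroid.midCount M p q : ℚ) +
      ({X : Set α | X ⊆ M.E ∧ M.eRk X ≤ q}.ncard : ℚ) +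
      ({X : Set α | X ⊆ M.E ∧ M.eRk X = M.eRank}.ncard : ℚ) := by exact_mod_cast hY
  have hABq : 8 * (({X : Set α | X ⊆ M.E ∧ M.eRk X ≤ q}.ncard : ℚ) +
      ({X : Set α | X ⊆ M.E ∧ M.eRk X = M.eRank}.ncard : ℚ)) ≤ 2 ^ (p + d) := by exact_mod_cast hAB
  have hpolyq : 8 * (((p + d).choose q : ℚ) + (N : ℚ)) ≤ 7 * 2 ^ (d - q) * ((p + q).choose q : ℚ) := by
    exact_mod_cast hpoly
  have hU0 : (0 : ℚ) ≤ (Matroid.topCount M p q : ℚ) := Nat.cast_nonneg _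
  exact level_arith (p := p) (d := d) (n := p + d) (q := q) rfl (by omega) hΦ hU0 hUq hYq hABq hpolyq

/-- **The level step with the single-exponential threshold**: level `q` for all `p ≥ P` and `P ≥ Tcap (q+1)` give
level `q + 1` for all `p ≥ P + 1` (`rls_succ_large` with `D = q + 1`; the core is `c025_core_cap_bounded` /
`c025_core_explicit_large'` at level `q + 1`). -/
theorem c025_succ_cap (q : ℕ) (hq : 3 ≤ q) (P : ℕ) (hP : Explicit.Tcap (q + 1) ≤ P)
    (hprev : ∀ (M : Matroid α) [M.Finite] (p : ℕ), P ≤ p → q + 2 ≤ p → RLS M p q) :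
    ∀ (M : Matroid α) [M.Finite] (p : ℕ), P + 1 ≤ p → RLS M p (q + 1) := by
  intro M _ p hp
  obtain ⟨hN₁, -, -, -, hq3⟩ := Explicit.Tcap_bounds (q + 1) (by omega)
  refine rls_succ_large (α := α) q (q + 1) P hprev ?_ ?_ M p hp (by omega)
  · -- corank `≤ q + 1`: `U = ∅` or Theorem M
    intro M' _ p' _ hn _
    rcases Nat.lt_or_ge M'.E.ncard (p' + (q + 1)) with h | h
    · exact RLS_of_ncard_lt M' h
    · exact RLS_of_ncard_eq M' (by omega)
  · -- the core at level `q + 1`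
    intro M' _ p' hP' hR hbig _ hfree
    rcases Nat.lt_or_ge M'.E.ncard (p' + (q + 1) + 2 ^ (q + 1) + 1) with h | h
    · exact c025_core_cap_bounded (q + 1) (by omega) M' p' (M'.E.ncard - p') (hP.trans hP')
        (by omega) (by omega) hR (by omega) hfree
    · exact c025_core_explicit_large' (q + 1) (by omega) M' p' (by omega) hR (by omega) hfree

/-- **THE SINGLE-EXPONENTIAL THRESHOLD SEQUENCE** `Pcap`: `Pcap 3 = 5` (the `q = 3` row), and
`Pcap (q+1) = max (Pcap q) (Tcap (q+1)) + 1` for `q ≥ 3`. -/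
def Pcap : ℕ → ℕ
  | 0 => 5
  | 1 => 5
  | 2 => 5
  | 3 => 5
  | q + 4 => max (Pcap (q + 3)) (Explicit.Tcap (q + 4)) + 1

/-- The recursion of `Pcap` at `q ≥ 3`. -/
theorem Pcap_succ (q : ℕ) (hq : 3 ≤ q) : Pcap (q + 1) = max (Pcap q) (Explicit.Tcap (q + 1)) + 1 := by
  obtain ⟨k, rfl⟩ : ∃ k, q = k + 3 := ⟨q - 3, by omega⟩
  rfl

/-- **THEOREM P‴ — C-025 AT EVERY LEVEL `q ≥ 3` FOR EVERY FINITE MATROID AND EVERY `p ≥ Pcap q`**, with the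
SINGLE-EXPONENTIAL threshold `Pcap` (induction on `q` from the `q = 3` row `SevenThree.c025_three_all` through
`c025_succ_cap`). -/
theorem c025_cap_all (q : ℕ) (hq : 3 ≤ q) :
    ∀ (M : Matroid α) [M.Finite] (p : ℕ), Pcap q ≤ p → RLS M p q := by
  induction q, hq using Nat.le_induction with
  | base =>
    intro M _ p hp
    exact SevenThree.c025_three_all M p hp
  | succ q hq ih =>
    intro M _ p hp
    rw [Pcap_succ q hq] at hp
    refine c025_succ_cap q hq (max (Pcap q) (Explicit.Tcap (q + 1))) (le_max_right _ _) ?_ M p hp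
    intro M' _ p' hP' _
    exact ih M' p' ((le_max_left _ _).trans hP')

/-- THEOREM P‴ in the literal `C025` body at `(p, q)`. -/
theorem c025_cap_all' (q : ℕ) (hq : 3 ≤ q) (M : Matroid α) [M.Finite] (p : ℕ) (hp : Pcap q ≤ p) :
    phiK p q * ({A : Set α | A ⊆ M.E ∧ M.eRk A = (p : ℕ∞) ∧ M.eRk (M.E \ A) = (q : ℕ∞)}.ncard : ℚ) ≤
      ({A : Set α | A ⊆ M.E ∧ (q : ℕ∞) < M.eRk A ∧ M.eRk A < (p : ℕ∞)}.ncard : ℚ) :=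
  c025_cap_all q hq M p hp

/-- **THE CLOSED FORM**: `Pcap q ≤ Tcap q + 1 = (q + 2)·2^{2q+6} + 1` for every `q ≥ 4`. -/
theorem Pcap_le_Tcap_succ (q : ℕ) (hq : 4 ≤ q) : Pcap q ≤ Explicit.Tcap q + 1 := by
  induction q, hq using Nat.le_induction with
  | base =>
    show max (Pcap 3) (Explicit.Tcap 4) + 1 ≤ Explicit.Tcap 4 + 1
    have : Pcap 3 ≤ Explicit.Tcap 4 := by
      show 5 ≤ Explicit.Tcap 4
      unfold Explicit.Tcap; norm_num
    omega
  | succ q hq ih =>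
    rw [Pcap_succ q (by omega)]
    have h := Explicit.Tcap_le_Tcap_succ q
    have hpos : 1 ≤ Explicit.Tcap q := by
      unfold Explicit.Tcap
      have h2 : 1 ≤ 2 ^ (2 * q + 6) := Nat.one_le_two_pow
      nlinarith
    have : max (Pcap q) (Explicit.Tcap (q + 1)) ≤ Explicit.Tcap (q + 1) := max_le (by omega) le_rfl
    omega

/-- **THE ROWS OF S4 (`q ≥ 7`) WITH A SINGLE-EXPONENTIAL THRESHOLD**: C-025 at level `q` for every
`p ≥ (q + 2)·2^{2q+6} + 1`. -/
theorem c025_cap_seven_up (q : ℕ) (hq : 7 ≤ q) (M : Matroid α) [M.Finite] (p : ℕ)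
    (hp : (q + 2) * 2 ^ (2 * q + 6) + 1 ≤ p) : RLS M p q :=
  c025_cap_all q (by omega) M p ((Pcap_le_Tcap_succ q (by omega)).trans hp)

end ThmN

end PercRepro
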